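import Mathlib
import Summits.NavierStokesRegularity.NavierStokesRegularity.Theorems.FilamentSkeletonRssKelvinGateSharpPicard
import Summits.NavierStokesRegularity.NavierStokesRegularity.Theorems.FilamentSkeletonRssKelvinGateTools

/-!
# Route `FilamentSkeletonRss` · crux `TransverseReduction1A` (stmt-27414; successor of the aside `TransverseReductionRJ`,
# stmt-21221) — line `kelvin_gate`: SMALL FORCED ROTATING-LERAY PROFILES at the trivial base (S2′ + S3′ closed at `U⁰ = 0`)

Helper file (theorems only, `--as helper`).  HONEST FRAMING: analysis bookkeeping for a HYPOTHETICAL filament-type rotating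
self-similar blow-up route; nothing here bears on Navier–Stokes regularity; no stub is proved here; this is the FREE-BASE
instance of the line's «gate + contraction» mechanism, far from the crux (which needs a non-trivial dressed base and `U ≠ 0`
WITHOUT forcing).

* `lerayOp_eq_lerayLin_zero_add` — `E_α(W) = 𝓛_(α,0) W + DW[W]` pointwise (`E_α = lerayOp α`, the full profile operator);
* `small_free_profiles` — **for `1 < a < 2` there are `C ≥ 0`, `ε₀ > 0` such that for EVERY rotation rate `α` and every forcing
  `g` with `YSharp a g ε`, `ε ≤ ε₀`, there are `W ∈ C²` with `XSharp a W (C ε)`, `div W = 0`, and `Q ∈ C¹`, `|Q| ≤ C ε`, solving the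
  steady forced rotating Leray profile system `α(e₃ × W − DW[e₃ × y]) + ½W + ½DW[y] − ΔW + DW[W] + ∇Q = g` pointwise** —
  the free sharp gate (`free_kelvin_gate_ySharp`, linear by `sharpGate_add_smul`) fed into the sharp Picard iteration
  (`sharp_picard_exists_fixedPoint`) with residual `r = −g`.
-/

set_option linter.dupNamespace false

noncomputable section

namespace Summit.NavierStokesRegularity.NavierStokesRegularity.Theorems.KelvinGate

open Set Function Filter Topology InnerProductSpace MeasureTheory Real Metric
open Literature.Analysis.FluidPDE Literature.Analysis.FluidPDE.NewtonPotentialHolder Literature.Analysis.UnboundedOperators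
open scoped Laplacian RealInnerProductSpace ContDiff Topology ENNReal BigOperators

/-- `E_α(W)(y) = 𝓛_(α,0) W (y) + DW(y)[W(y)]` (the base-point terms `DW[0]`, `D0[W]` of the linearisation vanish). -/
theorem lerayOp_eq_lerayLin_zero_add (α : ℝ) (W : EuclideanSpace ℝ (Fin 3) → EuclideanSpace ℝ (Fin 3)) (y : EuclideanSpace ℝ (Fin 3)) :
    lerayOp α W y = lerayLin α (fun _ => 0) W y + fderiv ℝ W y (W y) := by
  unfold lerayOp lerayLin
  simp only [map_zero, fderiv_fun_const, Pi.zero_apply, zero_apply, add_zero]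

/-- **SMALL FORCED ROTATING-LERAY PROFILES AT THE TRIVIAL BASE.**  See the module docstring. -/
theorem small_free_profiles {a : ℝ} (ha1 : 1 < a) (ha2 : a < 2) :
    ∃ C ε₀ : ℝ, 0 ≤ C ∧ 0 < ε₀ ∧ ∀ (α : ℝ) (g : EuclideanSpace ℝ (Fin 3) → EuclideanSpace ℝ (Fin 3)) (ε : ℝ),
      YSharp a g ε → ε ≤ ε₀ →
      ∃ (W : EuclideanSpace ℝ (Fin 3) → EuclideanSpace ℝ (Fin 3)) (Q : EuclideanSpace ℝ (Fin 3) → ℝ),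
        XSharp a W (C * ε) ∧ ContDiff ℝ 1 Q ∧ VectorCalculus.IsDivFree W ∧ (∀ y, |Q y| ≤ C * ε) ∧
        ∀ y, lerayOp α W y + gradient Q y = g y := by
  obtain ⟨C, hC0, hgate⟩ := free_kelvin_gate_ySharp ha1 ha2
  refine ⟨2 * C, 1 / (16 * (C + 1) ^ 2), by positivity, by positivity, ?_⟩
  intro α g ε hg hε
  have hε0 : 0 ≤ ε := hg.nonneg
  -- the gate as an operator `K` on forcings
  obtain ⟨K, hK⟩ : ∃ K : (EuclideanSpace ℝ (Fin 3) → EuclideanSpace ℝ (Fin 3)) → EuclideanSpace ℝ (Fin 3) →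
      EuclideanSpace ℝ (Fin 3), ∀ F, K F = fun y => ∫ s in Ioi (0:ℝ), (Real.exp (-(s / 2)) • rotZL (-(α * s)))
      (heatExtension (fun x => F x - gradient (fun x => ∑ j : Fin 3,
        newtonGradPotential (EuclideanSpace.single j (1:ℝ)) (fun y => F y j) x) x)
        (1 - Real.exp (-s)) ((Real.exp (-(s / 2)) • rotZL (α * s)) y)) := ⟨_, fun F => rfl⟩
  have hK1 : ∀ (F : EuclideanSpace ℝ (Fin 3) → EuclideanSpace ℝ (Fin 3)) (R : ℝ), YSharp a F R → XSharp a (K F) (C * R) :=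
    fun F R hF => by rw [hK F]; exact (hgate α F R hF).1
  have hK2 : ∀ (F G : EuclideanSpace ℝ (Fin 3) → EuclideanSpace ℝ (Fin 3)) (s : ℝ), (∃ R, YSharp a F R) →
      (∃ R, YSharp a G R) → K (fun y => F y + s • G y) = fun y => K F y + s • K G y := by
    intro F G s ⟨R, hF⟩ ⟨R', hG⟩
    rw [hK, hK F, hK G]
    funext y
    exact sharpGate_add_smul ha1.le hF hG s α y
  -- smallness `16 C² ε ≤ 1`
  have hA : 16 * C ^ 2 * ε ≤ 1 := by
    have h1 : 16 * C ^ 2 * ε ≤ 16 * C ^ 2 * (1 / (16 * (C + 1) ^ 2)) := mul_le_mul_of_nonneg_left hε (by positivity)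
    have h2 : 16 * C ^ 2 * (1 / (16 * (C + 1) ^ 2)) = C ^ 2 / (C + 1) ^ 2 := by field_simp
    have h3 : C ^ 2 / (C + 1) ^ 2 ≤ 1 := by
      rw [div_le_one (by positivity)]; nlinarith
    linarith
  -- Picard with residual `r = −g`
  obtain ⟨F, hF, hfix⟩ := sharp_picard_exists_fixedPoint (K := K) (A := C) ha1.le hK1 hK2 hg.neg hA
  obtain ⟨hX, hdiv, hQ1, hQb, -, heq⟩ := hgate α F (2 * ε) hF
  rw [hK F] at hfix
  refine ⟨_, _, hX.mono (le_of_eq (by ring)), hQ1, hdiv, fun y => (hQb y).trans (le_of_eq (by ring)), fun y => ?_⟩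
  rw [lerayOp_eq_lerayLin_zero_add, add_right_comm, heq y, hfix y]
  simp

end Summit.NavierStokesRegularity.NavierStokesRegularity.Theorems.KelvinGate

end
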